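import Mathlib
import HarnessLib
import Summits.ValiantsHypothesis.ValiantsHypothesis.Theorems.LacunarySymmetroidMatrixDescartesFoldLawTwoKCurve
import Summits.ValiantsHypothesis.ValiantsHypothesis.Theorems.LacunarySymmetroidMatrixDescartesOsculationLawTwoKSupport
import Summits.ValiantsHypothesis.ValiantsHypothesis.Theorems.LacunarySymmetroidMatrixDescartesOsculationLawTwoKPencil

/-!
# ValiantsHypothesis / LacunarySymmetroid — crux `MatrixDescartes` (stmt-ValiantsHypothesis-18050, V1),
# line `Cruxes/MatrixDescartes/Lines/definite_pair_fold_law.lean` («definite-pair-fold-law»): the `m = 2` RUNG of the fold law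

The line's LAW is `FoldLaw : ∃ C, ∀ m K, FoldLawAt m K (2^(C (K + log₂² m)))`, with
`FoldLawAt m K B := ∀ d P Q, IsDefinitePair P Q → SimpleSpectrum d P Q → (foldSet d P Q).Finite →
(foldSet d P Q).ncard ≤ B` (`foldSet` = points `x > 0, y > 0` of the spectral curve `det(A(x) − y·C(x)) = 0` of the
definite pair `A = Σ x^(d l) P_l`, `C = Σ x^(d l) Q_l` where `θ_x` of the determinant vanishes).  The first rung
`FoldLawAt 1 K (K^2)` is p596879.  This file proves the SECOND rung unconditionally, with an explicit polynomial
budget: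

  `foldLawAt_two (K)` (per definite pair, the v1 currency of p596879) and `foldLawAt_two_kmin (K)` =
  `FoldLawAt 2 K (2 · K ^ 8)` in the line's v2 `κ_min` form (03:14Z), both with the vocabulary UNFOLDED verbatim.

For `2 × 2` letters, `det(A − y C) = a·y² + m·y + δ` with `a = det C`, `δ = det A`,
`m = −(A₀₀C₁₁ + A₁₁C₀₀ − A₀₁C₁₀ − A₁₀C₀₁)`; definiteness gives `C(x) ≻ 0` and `A(x) ≻ 0` for `x > 0`
(`posDef_pencil_eval`), hence `a(x) > 0`, no root `y ≤ 0`, and a nonnegative discriminant (test point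
`y* = A₀₀/C₀₀`: `det(A − y*C) = −(A₀₁ − y*C₀₁)² ≤ 0` and `m² − 4aδ = (2a y* + m)² − 4a·det(A − y*C)`).  The fold
curve count `FoldCurve.fold_curve_ncard_le` then gives `≤ 2·|supp N|`, and `supp N ⊆ 8 • image d` (sumset
bookkeeping of `…OsculationLawTwoKSupport`) gives `|supp N| ≤ K⁸`.

Honest framing.  A located RUNG (`m = 2`, all `K`) of an UNREGISTERED, critic-gated V1 law line with a
Descartes/resultant CEILING `2K⁸`; `SimpleSpectrum` is idle at `m = 2`.  `FoldLaw` for general `m`,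
`MorseInequality` (`stub_morse`), `stub_generic`, `MatrixDescartes`, Conjecture B and `VP ≠ VNP` are OPEN /
NOT proved; nothing here is progress on them.  No definitions, no named facts; Mathlib only.
-/

-- `Summit.ValiantsHypothesis.ValiantsHypothesis.…` is the tree's mandated single-conjunct layout (Sub = Summit).
set_option linter.dupNamespace false

noncomputable section

namespace Summit.ValiantsHypothesis.ValiantsHypothesis.Theorems.LacunarySymmetroidMatrixDescartes

open Polynomial Matrix
open scoped BigOperators Pointwise

namespace FoldTwoK

/-! ### Definite pencils evaluated at `t > 0` -/

/-- Entries of the pencil evaluate to the entries of `Σ t^(d l) • T l`. [folklore] -/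
theorem eval_pencil_apply {K : ℕ} (d : Fin K → ℕ) (T : Fin K → Matrix (Fin 2) (Fin 2) ℝ) (i j : Fin 2) (t : ℝ) :
    ((∑ l, (X : ℝ[X]) ^ d l • (T l).map Polynomial.C) i j).eval t = (∑ l, t ^ d l • T l) i j := by
  rw [OsculationTwoK.pencil_apply]
  simp only [eval_finsetSum, eval_mul, eval_C, eval_pow, eval_X, Matrix.sum_apply, Matrix.smul_apply,
    smul_eq_mul]
  exact Finset.sum_congr rfl fun l _ => mul_comm _ _

/-- `Σ t^(d l) • T l ≻ 0` for `t > 0` when the letters are semidefinite with definite sum. [folklore] -/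
theorem posDef_pencil_eval {K : ℕ} (d : Fin K → ℕ) (T : Fin K → Matrix (Fin 2) (Fin 2) ℝ)
    (hT : ∀ l, (T l).PosSemidef) (hsum : (∑ l, T l).PosDef) {t : ℝ} (ht : 0 < t) :
    (∑ l, t ^ d l • T l).PosDef := by
  set c : ℝ := (min 1 t) ^ (Finset.univ.sup d) with hc
  have hmin0 : 0 < min 1 t := lt_min one_pos ht
  have hcpos : 0 < c := pow_pos hmin0 _
  have hcle : ∀ l, c ≤ t ^ d l := by
    intro l
    calc c ≤ (min 1 t) ^ d l :=
          pow_le_pow_of_le_one hmin0.le (min_le_left _ _) (Finset.le_sup (Finset.mem_univ l))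
      _ ≤ t ^ d l := pow_le_pow_left₀ hmin0.le (min_le_right _ _) _
  have hsplit : ∑ l, t ^ d l • T l = c • (∑ l, T l) + ∑ l, (t ^ d l - c) • T l := by
    rw [Finset.smul_sum, ← Finset.sum_add_distrib]
    exact Finset.sum_congr rfl fun l _ => by rw [← add_smul, add_sub_cancel]
  rw [hsplit]
  exact (hsum.smul hcpos).add_posSemidef
    (posSemidef_sum Finset.univ fun l _ => (hT l).smul (sub_nonneg.2 (hcle l)))

/-- Semidefinite letters are symmetric, and so is the evaluated pencil. [folklore] -/
theorem pencil_eval_symm {K : ℕ} (d : Fin K → ℕ) (T : Fin K → Matrix (Fin 2) (Fin 2) ℝ)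
    (hT : ∀ l, (T l).PosSemidef) (t : ℝ) (i j : Fin 2) :
    (∑ l, t ^ d l • T l) i j = (∑ l, t ^ d l • T l) j i := by
  simp only [Matrix.sum_apply, Matrix.smul_apply, smul_eq_mul]
  refine Finset.sum_congr rfl fun l _ => ?_
  have h := (hT l).isHermitian.apply i j
  rw [star_trivial] at h
  rw [h]

/-! ### The pair polynomial at `m = 2` -/

/-- Entries of `Σ_l X₀^(d l) • (P_l − X₁ Q_l)`. [folklore] -/
theorem pair_apply {K : ℕ} (d : Fin K → ℕ) (P Q : Fin K → Matrix (Fin 2) (Fin 2) ℝ) (i j : Fin 2) :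
    (∑ l, (MvPolynomial.X (0 : Fin 2) : MvPolynomial (Fin 2) ℝ) ^ d l •
        ((P l).map (MvPolynomial.C : ℝ →+* MvPolynomial (Fin 2) ℝ) - (MvPolynomial.X (1 : Fin 2) : MvPolynomial (Fin 2) ℝ) • (Q l).map (MvPolynomial.C : ℝ →+* MvPolynomial (Fin 2) ℝ))) i j =
      Polynomial.aeval (MvPolynomial.X 0 : MvPolynomial (Fin 2) ℝ) ((∑ l, (X : ℝ[X]) ^ d l • (P l).map Polynomial.C) i j) - MvPolynomial.X 1 * Polynomial.aeval (MvPolynomial.X 0 : MvPolynomial (Fin 2) ℝ) ((∑ l, (X : ℝ[X]) ^ d l • (Q l).map Polynomial.C) i j) := by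
  rw [OsculationTwoK.pencil_apply, OsculationTwoK.pencil_apply]
  simp only [Matrix.sum_apply, Matrix.smul_apply, Matrix.sub_apply, Matrix.map_apply, smul_eq_mul, map_sum,
    map_mul, map_pow, Polynomial.aeval_X, Polynomial.aeval_C, MvPolynomial.algebraMap_eq, Finset.mul_sum,
    ← Finset.sum_sub_distrib]
  exact Finset.sum_congr rfl fun l _ => by ring

/-- At `m = 2` the pair polynomial is `X₁X₁·ι a + X₁·ι m + ι δ` with `a = det C`, `δ = det A` and the mixed
term `m`. [folklore] -/
theorem pairPoly_two_eq {K : ℕ} (d : Fin K → ℕ) (P Q : Fin K → Matrix (Fin 2) (Fin 2) ℝ) :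
    (∑ l, (MvPolynomial.X (0 : Fin 2) : MvPolynomial (Fin 2) ℝ) ^ d l •
              ((P l).map (MvPolynomial.C : ℝ →+* MvPolynomial (Fin 2) ℝ)
                - (MvPolynomial.X (1 : Fin 2) : MvPolynomial (Fin 2) ℝ) • (Q l).map (MvPolynomial.C : ℝ →+* MvPolynomial (Fin 2) ℝ))).det =
      MvPolynomial.X 1 * MvPolynomial.X 1 * Polynomial.aeval (MvPolynomial.X 0 : MvPolynomial (Fin 2) ℝ) ((∑ l, (X : ℝ[X]) ^ d l • (Q l).map Polynomial.C) 0 0 * (∑ l, (X : ℝ[X]) ^ d l • (Q l).map Polynomial.C) 1 1 - (∑ l, (X : ℝ[X]) ^ d l • (Q l).map Polynomial.C) 0 1 * (∑ l, (X : ℝ[X]) ^ d l • (Q l).map Polynomial.C) 1 0)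
        + MvPolynomial.X 1 * Polynomial.aeval (MvPolynomial.X 0 : MvPolynomial (Fin 2) ℝ) (-((∑ l, (X : ℝ[X]) ^ d l • (P l).map Polynomial.C) 0 0 * (∑ l, (X : ℝ[X]) ^ d l • (Q l).map Polynomial.C) 1 1 + (∑ l, (X : ℝ[X]) ^ d l • (P l).map Polynomial.C) 1 1 * (∑ l, (X : ℝ[X]) ^ d l • (Q l).map Polynomial.C) 0 0 - (∑ l, (X : ℝ[X]) ^ d l • (P l).map Polynomial.C) 0 1 * (∑ l, (X : ℝ[X]) ^ d l • (Q l).map Polynomial.C) 1 0 - (∑ l, (X : ℝ[X]) ^ d l • (P l).map Polynomial.C) 1 0 * (∑ l, (X : ℝ[X]) ^ d l • (Q l).map Polynomial.C) 0 1))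
        + Polynomial.aeval (MvPolynomial.X 0 : MvPolynomial (Fin 2) ℝ) ((∑ l, (X : ℝ[X]) ^ d l • (P l).map Polynomial.C) 0 0 * (∑ l, (X : ℝ[X]) ^ d l • (P l).map Polynomial.C) 1 1 - (∑ l, (X : ℝ[X]) ^ d l • (P l).map Polynomial.C) 0 1 * (∑ l, (X : ℝ[X]) ^ d l • (P l).map Polynomial.C) 1 0) := by
  rw [Matrix.det_fin_two, pair_apply, pair_apply, pair_apply, pair_apply]
  simp only [map_add, map_sub, map_mul, map_neg]
  ring

/-! ### Supports -/

/-- Negation keeps the support. [folklore] -/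
theorem supp_neg' {S : Finset ℕ} {p : ℝ[X]} (h : p.support ⊆ S) : (-p).support ⊆ S := by
  rwa [Polynomial.support_neg]

/-- `supp N ⊆ 8 • E` when `a, m, δ ⊆ 2 • E`. [folklore] -/
theorem supp_N {E : Finset ℕ} {a m δ : ℝ[X]} (ha2 : a.support ⊆ 2 • E) (hm2 : m.support ⊆ 2 • E)
    (hd2 : δ.support ⊆ 2 • E) :
    (a ^ 2 * (X * derivative δ) ^ 2 - a * m * (X * derivative m) * (X * derivative δ) - 2 * a * δ * (X * derivative a) * (X * derivative δ) + a * δ * (X * derivative m) ^ 2 + m ^ 2 * (X * derivative a) * (X * derivative δ) - m * δ * (X * derivative a) * (X * derivative m) + δ ^ 2 * (X * derivative a) ^ 2).support ⊆ 8 • E := by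
  have ha2t := OsculationCusp.supp_theta ha2
  have hm2t := OsculationCusp.supp_theta hm2
  have hd2t := OsculationCusp.supp_theta hd2
  exact (OsculationCusp.supp_add (OsculationCusp.supp_sub (OsculationCusp.supp_add (OsculationCusp.supp_add (OsculationCusp.supp_sub (OsculationCusp.supp_sub (OsculationCusp.supp_cast (OsculationCusp.supp_mul (OsculationCusp.supp_pow ha2 2 (by norm_num)) (OsculationCusp.supp_pow hd2t 2 (by norm_num))) (by norm_num)) (OsculationCusp.supp_cast (OsculationCusp.supp_mul (OsculationCusp.supp_mul (OsculationCusp.supp_mul ha2 hm2) hm2t) hd2t) (by norm_num))) (OsculationCusp.supp_cast (OsculationCusp.supp_mul (OsculationCusp.supp_mul (OsculationCusp.supp_mul (OsculationCusp.supp_ofNat_mul 2 ha2) hd2) ha2t) hd2t) (by norm_num))) (OsculationCusp.supp_cast (OsculationCusp.supp_mul (OsculationCusp.supp_mul ha2 hd2) (OsculationCusp.supp_pow hm2t 2 (by norm_num))) (by norm_num))) (OsculationCusp.supp_cast (OsculationCusp.supp_mul (OsculationCusp.supp_mul (OsculationCusp.supp_pow hm2 2 (by norm_num)) ha2t) hd2t)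 (by norm_num))) (OsculationCusp.supp_cast (OsculationCusp.supp_mul (OsculationCusp.supp_mul (OsculationCusp.supp_mul hm2 hd2) ha2t) hm2t) (by norm_num))) (OsculationCusp.supp_cast (OsculationCusp.supp_mul (OsculationCusp.supp_pow hd2 2 (by norm_num)) (OsculationCusp.supp_pow ha2t 2 (by norm_num))) (by norm_num)))

/-! ### The rung -/

/-- **`FoldLawAt 2 K (2 · K ^ 8)`** (the line's `FoldLawAt`/`IsDefinitePair`/`SimpleSpectrum`/`foldSet`/`pairPoly`/
`euler` UNFOLDED verbatim): for every exponent vector `d : Fin K → ℕ` and every definite pair of `2 × 2` letter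
families `P Q`, a finite fold set has at most `2K⁸` points.  `SimpleSpectrum` is not used. -/
theorem foldLawAt_two (K : ℕ) :
    ∀ (d : Fin K → ℕ) (P Q : Fin K → Matrix (Fin 2) (Fin 2) ℝ),
      ((∀ l, (P l).PosSemidef) ∧ (∀ l, (Q l).PosSemidef) ∧ (∑ l, P l).PosDef ∧ (∑ l, Q l).PosDef) →
      (∀ p : Fin 2 → ℝ, 0 < p 0 → MvPolynomial.eval p (∑ l, (MvPolynomial.X (0 : Fin 2) : MvPolynomial (Fin 2) ℝ) ^ d l •
              ((P l).map (MvPolynomial.C : ℝ →+* MvPolynomial (Fin 2) ℝ)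
                - (MvPolynomial.X (1 : Fin 2) : MvPolynomial (Fin 2) ℝ) • (Q l).map (MvPolynomial.C : ℝ →+* MvPolynomial (Fin 2) ℝ))).det = 0 →
        MvPolynomial.eval p (MvPolynomial.pderiv 1 (∑ l, (MvPolynomial.X (0 : Fin 2) : MvPolynomial (Fin 2) ℝ) ^ d l •
              ((P l).map (MvPolynomial.C : ℝ →+* MvPolynomial (Fin 2) ℝ)
                - (MvPolynomial.X (1 : Fin 2) : MvPolynomial (Fin 2) ℝ) • (Q l).map (MvPolynomial.C : ℝ →+* MvPolynomial (Fin 2) ℝ))).det) ≠ 0) →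
      {p : Fin 2 → ℝ | 0 < p 0 ∧ 0 < p 1 ∧ MvPolynomial.eval p (∑ l, (MvPolynomial.X (0 : Fin 2) : MvPolynomial (Fin 2) ℝ) ^ d l •
              ((P l).map (MvPolynomial.C : ℝ →+* MvPolynomial (Fin 2) ℝ)
                - (MvPolynomial.X (1 : Fin 2) : MvPolynomial (Fin 2) ℝ) • (Q l).map (MvPolynomial.C : ℝ →+* MvPolynomial (Fin 2) ℝ))).det = 0 ∧
      MvPolynomial.eval p (MvPolynomial.X 0 * MvPolynomial.pderiv 0 (∑ l, (MvPolynomial.X (0 : Fin 2) : MvPolynomial (Fin 2) ℝ) ^ d l •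
              ((P l).map (MvPolynomial.C : ℝ →+* MvPolynomial (Fin 2) ℝ)
                - (MvPolynomial.X (1 : Fin 2) : MvPolynomial (Fin 2) ℝ) • (Q l).map (MvPolynomial.C : ℝ →+* MvPolynomial (Fin 2) ℝ))).det) = 0}.Finite →
      {p : Fin 2 → ℝ | 0 < p 0 ∧ 0 < p 1 ∧ MvPolynomial.eval p (∑ l, (MvPolynomial.X (0 : Fin 2) : MvPolynomial (Fin 2) ℝ) ^ d l •
              ((P l).map (MvPolynomial.C : ℝ →+* MvPolynomial (Fin 2) ℝ)
                - (MvPolynomial.X (1 : Fin 2) : MvPolynomial (Fin 2) ℝ) • (Q l).map (MvPolynomial.C : ℝ →+* MvPolynomial (Fin 2) ℝ))).det = 0 ∧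
      MvPolynomial.eval p (MvPolynomial.X 0 * MvPolynomial.pderiv 0 (∑ l, (MvPolynomial.X (0 : Fin 2) : MvPolynomial (Fin 2) ℝ) ^ d l •
              ((P l).map (MvPolynomial.C : ℝ →+* MvPolynomial (Fin 2) ℝ)
                - (MvPolynomial.X (1 : Fin 2) : MvPolynomial (Fin 2) ℝ) • (Q l).map (MvPolynomial.C : ℝ →+* MvPolynomial (Fin 2) ℝ))).det) = 0}.ncard ≤ 2 * K ^ 8 := by
  intro d P Q hdef _hsimple hfin
  classical
  obtain ⟨hP, hQ, hPsum, hQsum⟩ := hdef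
  -- real matrices at `t`
  have hCt : ∀ t : ℝ, 0 < t → (∑ l, t ^ d l • Q l).PosDef := fun t ht => posDef_pencil_eval d Q hQ hQsum ht
  have hAt : ∀ t : ℝ, 0 < t → (∑ l, t ^ d l • P l).PosDef := fun t ht => posDef_pencil_eval d P hP hPsum ht
  -- evaluations of `a`, `m`, `δ`
  have ha_eval : ∀ t : ℝ, (((∑ l, (X : ℝ[X]) ^ d l • (Q l).map Polynomial.C) 0 0 * (∑ l, (X : ℝ[X]) ^ d l • (Q l).map Polynomial.C) 1 1 - (∑ l, (X : ℝ[X]) ^ d l • (Q l).map Polynomial.C) 0 1 * (∑ l, (X : ℝ[X]) ^ d l • (Q l).map Polynomial.C) 1 0)).eval t =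
      (∑ l, t ^ d l • Q l) 0 0 * (∑ l, t ^ d l • Q l) 1 1 - (∑ l, t ^ d l • Q l) 0 1 * (∑ l, t ^ d l • Q l) 1 0 := by
    intro t; simp only [eval_sub, eval_mul, eval_pencil_apply]
  have hd_eval : ∀ t : ℝ, (((∑ l, (X : ℝ[X]) ^ d l • (P l).map Polynomial.C) 0 0 * (∑ l, (X : ℝ[X]) ^ d l • (P l).map Polynomial.C) 1 1 - (∑ l, (X : ℝ[X]) ^ d l • (P l).map Polynomial.C) 0 1 * (∑ l, (X : ℝ[X]) ^ d l • (P l).map Polynomial.C) 1 0)).eval t =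
      (∑ l, t ^ d l • P l) 0 0 * (∑ l, t ^ d l • P l) 1 1 - (∑ l, t ^ d l • P l) 0 1 * (∑ l, t ^ d l • P l) 1 0 := by
    intro t; simp only [eval_sub, eval_mul, eval_pencil_apply]
  have hm_eval : ∀ t : ℝ, ((-((∑ l, (X : ℝ[X]) ^ d l • (P l).map Polynomial.C) 0 0 * (∑ l, (X : ℝ[X]) ^ d l • (Q l).map Polynomial.C) 1 1 + (∑ l, (X : ℝ[X]) ^ d l • (P l).map Polynomial.C) 1 1 * (∑ l, (X : ℝ[X]) ^ d l • (Q l).map Polynomial.C) 0 0 - (∑ l, (X : ℝ[X]) ^ d l • (P l).map Polynomial.C) 0 1 * (∑ l, (X : ℝ[X]) ^ d l • (Q l).map Polynomial.C) 1 0 - (∑ l, (X : ℝ[X]) ^ d l • (P l).map Polynomial.C) 1 0 * (∑ l, (X : ℝ[X]) ^ d l • (Q l).map Polynomial.C) 0 1))).eval t =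
      -((∑ l, t ^ d l • P l) 0 0 * (∑ l, t ^ d l • Q l) 1 1 + (∑ l, t ^ d l • P l) 1 1 * (∑ l, t ^ d l • Q l) 0 0
        - (∑ l, t ^ d l • P l) 0 1 * (∑ l, t ^ d l • Q l) 1 0 - (∑ l, t ^ d l • P l) 1 0 * (∑ l, t ^ d l • Q l) 0 1) := by
    intro t; simp only [eval_neg, eval_add, eval_sub, eval_mul, eval_pencil_apply]
  -- `f_t(y) = det(A(t) + (−y) C(t))`
  have hf_det : ∀ t y : ℝ, (((∑ l, (X : ℝ[X]) ^ d l • (Q l).map Polynomial.C) 0 0 * (∑ l, (X : ℝ[X]) ^ d l • (Q l).map Polynomial.C) 1 1 - (∑ l, (X : ℝ[X]) ^ d l • (Q l).map Polynomial.C) 0 1 * (∑ l, (X : ℝ[X]) ^ d l • (Q l).map Polynomial.C) 1 0)).eval t * y ^ 2 + ((-((∑ l, (X : ℝ[X]) ^ d l • (P l).map Polynomial.C) 0 0 * (∑ l, (X : ℝ[X]) ^ d l • (Q l).map Polynomial.C) 1 1 + (∑ l, (X : ℝ[X]) ^ d l • (P l).map Polynomial.C) 1 1 * (∑ l, (X :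 ℝ[X]) ^ d l • (Q l).map Polynomial.C) 0 0 - (∑ l, (X : ℝ[X]) ^ d l • (P l).map Polynomial.C) 0 1 * (∑ l, (X : ℝ[X]) ^ d l • (Q l).map Polynomial.C) 1 0 - (∑ l, (X : ℝ[X]) ^ d l • (P l).map Polynomial.C) 1 0 * (∑ l, (X : ℝ[X]) ^ d l • (Q l).map Polynomial.C) 0 1))).eval t * y + (((∑ l, (X : ℝ[X]) ^ d l • (P l).map Polynomial.C) 0 0 * (∑ l, (X : ℝ[X]) ^ d l • (P l).map Polynomial.C) 1 1 - (∑ l, (X : ℝ[X]) ^ d l • (P l).map Polynomial.C) 0 1 * (∑ l, (X : ℝ[X]) ^ d l • (P l).map Polynomial.C) 1 0)).eval t =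
      ((∑ l, t ^ d l • P l) + (-y) • (∑ l, t ^ d l • Q l)).det := by
    intro t y
    rw [ha_eval, hm_eval, hd_eval, Matrix.det_fin_two]
    simp only [Matrix.add_apply, Matrix.smul_apply, smul_eq_mul]
    ring
  -- (i) `a > 0`
  have ha : ∀ t : ℝ, 0 < t → 0 < (((∑ l, (X : ℝ[X]) ^ d l • (Q l).map Polynomial.C) 0 0 * (∑ l, (X : ℝ[X]) ^ d l • (Q l).map Polynomial.C) 1 1 - (∑ l, (X : ℝ[X]) ^ d l • (Q l).map Polynomial.C) 0 1 * (∑ l, (X : ℝ[X]) ^ d l • (Q l).map Polynomial.C) 1 0)).eval t := by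
    intro t ht
    rw [ha_eval, ← Matrix.det_fin_two]
    exact (hCt t ht).det_pos
  -- (ii) no root `y ≤ 0`
  have hpos : ∀ t y : ℝ, 0 < t → y ≤ 0 →
      (((∑ l, (X : ℝ[X]) ^ d l • (Q l).map Polynomial.C) 0 0 * (∑ l, (X : ℝ[X]) ^ d l • (Q l).map Polynomial.C) 1 1 - (∑ l, (X : ℝ[X]) ^ d l • (Q l).map Polynomial.C) 0 1 * (∑ l, (X : ℝ[X]) ^ d l • (Q l).map Polynomial.C) 1 0)).eval t * y ^ 2 + ((-((∑ l, (X : ℝ[X]) ^ d l • (P l).map Polynomial.C) 0 0 * (∑ l, (X : ℝ[X]) ^ d l • (Q l).map Polynomial.C) 1 1 + (∑ l, (X : ℝ[X]) ^ d l • (P l).map Polynomial.C) 1 1 * (∑ l, (X : ℝ[X]) ^ d l • (Q l).map Polynomial.C) 0 0 - (∑ l, (X : ℝ[X]) ^ d l • (P l).map Polynomial.C) 0 1 * (∑ l, (X : ℝ[X]) ^ d l • (Q l).map Polynomial.C) 1 0 - (∑ l, (X : ℝ[X]) ^ d l • (P l).map Polynomial.C) 1 0 * (∑ l, (X : ℝ[X])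 ^ d l • (Q l).map Polynomial.C) 0 1))).eval t * y + (((∑ l, (X : ℝ[X]) ^ d l • (P l).map Polynomial.C) 0 0 * (∑ l, (X : ℝ[X]) ^ d l • (P l).map Polynomial.C) 1 1 - (∑ l, (X : ℝ[X]) ^ d l • (P l).map Polynomial.C) 0 1 * (∑ l, (X : ℝ[X]) ^ d l • (P l).map Polynomial.C) 1 0)).eval t ≠ 0 := by
    intro t y ht hy
    rw [hf_det]
    exact ((hAt t ht).add_posSemidef ((hCt t ht).posSemidef.smul (by linarith))).det_pos.ne'
  -- (iii) nonnegative discriminant, via the test ordinate `y* = A₀₀/C₀₀`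
  have hdisc : ∀ t : ℝ, 0 < t → 4 * (((∑ l, (X : ℝ[X]) ^ d l • (Q l).map Polynomial.C) 0 0 * (∑ l, (X : ℝ[X]) ^ d l • (Q l).map Polynomial.C) 1 1 - (∑ l, (X : ℝ[X]) ^ d l • (Q l).map Polynomial.C) 0 1 * (∑ l, (X : ℝ[X]) ^ d l • (Q l).map Polynomial.C) 1 0)).eval t * (((∑ l, (X : ℝ[X]) ^ d l • (P l).map Polynomial.C) 0 0 * (∑ l, (X : ℝ[X]) ^ d l • (P l).map Polynomial.C) 1 1 - (∑ l, (X : ℝ[X]) ^ d l • (P l).map Polynomial.C) 0 1 * (∑ l, (X : ℝ[X]) ^ d l • (P l).map Polynomial.C) 1 0)).eval t ≤ (((-((∑ l, (X : ℝ[X]) ^ d l • (P l).map Polynomial.C) 0 0 * (∑ l, (X : ℝ[X]) ^ d l • (Q l).map Polynomial.C) 1 1 + (∑ l, (X : ℝ[X]) ^ d l • (P l).map Polynomial.C) 1 1 * (∑ l, (X : ℝ[X]) ^ d l • (Q l).map Polynomial.C) 0 0 - (∑ l, (X : ℝ[X]) ^ d l • (P l).map Polynomial.C) 0 1 * (∑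 l, (X : ℝ[X]) ^ d l • (Q l).map Polynomial.C) 1 0 - (∑ l, (X : ℝ[X]) ^ d l • (P l).map Polynomial.C) 1 0 * (∑ l, (X : ℝ[X]) ^ d l • (Q l).map Polynomial.C) 0 1))).eval t) ^ 2 := by
    intro t ht
    have hC00 : 0 < (∑ l, t ^ d l • Q l) 0 0 := (hCt t ht).diag_pos
    have hAs : (∑ l, t ^ d l • P l) 1 0 = (∑ l, t ^ d l • P l) 0 1 := pencil_eval_symm d P hP t 1 0
    have hCs : (∑ l, t ^ d l • Q l) 1 0 = (∑ l, t ^ d l • Q l) 0 1 := pencil_eval_symm d Q hQ t 1 0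
    have h00 : (∑ l, t ^ d l • P l) 0 0 - ((∑ l, t ^ d l • P l) 0 0 / (∑ l, t ^ d l • Q l) 0 0) * (∑ l, t ^ d l • Q l) 0 0 = 0 := by
      field_simp
      ring
    have hval : (((∑ l, (X : ℝ[X]) ^ d l • (Q l).map Polynomial.C) 0 0 * (∑ l, (X : ℝ[X]) ^ d l • (Q l).map Polynomial.C) 1 1 - (∑ l, (X : ℝ[X]) ^ d l • (Q l).map Polynomial.C) 0 1 * (∑ l, (X : ℝ[X]) ^ d l • (Q l).map Polynomial.C) 1 0)).eval t * ((∑ l, t ^ d l • P l) 0 0 / (∑ l, t ^ d l • Q l) 0 0) ^ 2 + ((-((∑ l, (X : ℝ[X]) ^ d l • (P l).map Polynomial.C) 0 0 * (∑ l, (X : ℝ[X]) ^ d l • (Q l).map Polynomial.C) 1 1 + (∑ l, (X : ℝ[X]) ^ d l • (P l).map Polynomial.C) 1 1 * (∑ l, (X : ℝ[X]) ^ d l • (Q l).map Polynomial.C) 0 0 - (∑ l, (X : ℝ[X]) ^ d l • (P l).map Polynomial.C) 0 1 * (∑ l, (X : ℝ[X]) ^ d l • (Q l).map Polynomial.C)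 1 0 - (∑ l, (X : ℝ[X]) ^ d l • (P l).map Polynomial.C) 1 0 * (∑ l, (X : ℝ[X]) ^ d l • (Q l).map Polynomial.C) 0 1))).eval t * ((∑ l, t ^ d l • P l) 0 0 / (∑ l, t ^ d l • Q l) 0 0)
        + (((∑ l, (X : ℝ[X]) ^ d l • (P l).map Polynomial.C) 0 0 * (∑ l, (X : ℝ[X]) ^ d l • (P l).map Polynomial.C) 1 1 - (∑ l, (X : ℝ[X]) ^ d l • (P l).map Polynomial.C) 0 1 * (∑ l, (X : ℝ[X]) ^ d l • (P l).map Polynomial.C) 1 0)).eval t = -((∑ l, t ^ d l • P l) 0 1 - ((∑ l, t ^ d l • P l) 0 0 / (∑ l, t ^ d l • Q l) 0 0) * (∑ l, t ^ d l • Q l) 0 1) ^ 2 := by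
      rw [ha_eval, hm_eval, hd_eval, hAs, hCs]
      linear_combination ((∑ l, t ^ d l • P l) 1 1 - ((∑ l, t ^ d l • P l) 0 0 / (∑ l, t ^ d l • Q l) 0 0) * (∑ l, t ^ d l • Q l) 1 1) * h00
    have hid : (((-((∑ l, (X : ℝ[X]) ^ d l • (P l).map Polynomial.C) 0 0 * (∑ l, (X : ℝ[X]) ^ d l • (Q l).map Polynomial.C) 1 1 + (∑ l, (X : ℝ[X]) ^ d l • (P l).map Polynomial.C) 1 1 * (∑ l, (X : ℝ[X]) ^ d l • (Q l).map Polynomial.C) 0 0 - (∑ l, (X : ℝ[X]) ^ d l • (P l).map Polynomial.C) 0 1 * (∑ l, (X : ℝ[X]) ^ d l • (Q l).map Polynomial.C) 1 0 - (∑ l, (X : ℝ[X]) ^ d l • (P l).map Polynomial.C) 1 0 * (∑ l, (X : ℝ[X]) ^ d l • (Q l).map Polynomial.C) 0 1))).eval t) ^ 2 - 4 * (((∑ l, (X : ℝ[X]) ^ d l • (Q l).map Polynomial.C) 0 0 * (∑ l, (X : ℝ[X]) ^ d l • (Q l).map Polynomial.C) 1 1 - (∑ l, (X : ℝ[X]) ^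 d l • (Q l).map Polynomial.C) 0 1 * (∑ l, (X : ℝ[X]) ^ d l • (Q l).map Polynomial.C) 1 0)).eval t * (((∑ l, (X : ℝ[X]) ^ d l • (P l).map Polynomial.C) 0 0 * (∑ l, (X : ℝ[X]) ^ d l • (P l).map Polynomial.C) 1 1 - (∑ l, (X : ℝ[X]) ^ d l • (P l).map Polynomial.C) 0 1 * (∑ l, (X : ℝ[X]) ^ d l • (P l).map Polynomial.C) 1 0)).eval t =
        (2 * (((∑ l, (X : ℝ[X]) ^ d l • (Q l).map Polynomial.C) 0 0 * (∑ l, (X : ℝ[X]) ^ d l • (Q l).map Polynomial.C) 1 1 - (∑ l, (X : ℝ[X]) ^ d l • (Q l).map Polynomial.C) 0 1 * (∑ l, (X : ℝ[X]) ^ d l • (Q l).map Polynomial.C) 1 0)).eval t * ((∑ l, t ^ d l • P l) 0 0 / (∑ l, t ^ d l • Q l) 0 0) + ((-((∑ l, (X : ℝ[X]) ^ d l • (P l).map Polynomial.C) 0 0 * (∑ l, (X : ℝ[X]) ^ d l • (Q l).map Polynomial.C) 1 1 + (∑ l, (X : ℝ[X]) ^ d l • (P l).map Polynomial.C) 1 1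 * (∑ l, (X : ℝ[X]) ^ d l • (Q l).map Polynomial.C) 0 0 - (∑ l, (X : ℝ[X]) ^ d l • (P l).map Polynomial.C) 0 1 * (∑ l, (X : ℝ[X]) ^ d l • (Q l).map Polynomial.C) 1 0 - (∑ l, (X : ℝ[X]) ^ d l • (P l).map Polynomial.C) 1 0 * (∑ l, (X : ℝ[X]) ^ d l • (Q l).map Polynomial.C) 0 1))).eval t) ^ 2
          - 4 * (((∑ l, (X : ℝ[X]) ^ d l • (Q l).map Polynomial.C) 0 0 * (∑ l, (X : ℝ[X]) ^ d l • (Q l).map Polynomial.C) 1 1 - (∑ l, (X : ℝ[X]) ^ d l • (Q l).map Polynomial.C) 0 1 * (∑ l, (X : ℝ[X]) ^ d l • (Q l).map Polynomial.C) 1 0)).eval t * ((((∑ l, (X : ℝ[X]) ^ d l • (Q l).map Polynomial.C) 0 0 * (∑ l, (X : ℝ[X]) ^ d l • (Q l).map Polynomial.C) 1 1 - (∑ l, (X : ℝ[X]) ^ d l • (Q l).map Polynomial.C) 0 1 * (∑ l, (X : ℝ[X]) ^ d l • (Q l).map Polynomial.C) 1 0)).eval t * ((∑ l, t ^ d l •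 P l) 0 0 / (∑ l, t ^ d l • Q l) 0 0) ^ 2
            + ((-((∑ l, (X : ℝ[X]) ^ d l • (P l).map Polynomial.C) 0 0 * (∑ l, (X : ℝ[X]) ^ d l • (Q l).map Polynomial.C) 1 1 + (∑ l, (X : ℝ[X]) ^ d l • (P l).map Polynomial.C) 1 1 * (∑ l, (X : ℝ[X]) ^ d l • (Q l).map Polynomial.C) 0 0 - (∑ l, (X : ℝ[X]) ^ d l • (P l).map Polynomial.C) 0 1 * (∑ l, (X : ℝ[X]) ^ d l • (Q l).map Polynomial.C) 1 0 - (∑ l, (X : ℝ[X]) ^ d l • (P l).map Polynomial.C) 1 0 * (∑ l, (X : ℝ[X]) ^ d l • (Q l).map Polynomial.C) 0 1))).eval t * ((∑ l, t ^ d l • P l) 0 0 / (∑ l, t ^ d l • Q l) 0 0) + (((∑ l, (X : ℝ[X]) ^ d l • (P l).map Polynomial.C) 0 0 * (∑ l, (X : ℝ[X]) ^ d l • (P l).map Polynomial.C) 1 1 - (∑ l, (X : ℝ[X]) ^ d l • (P l).map Polynomial.C) 0 1 * (∑ l, (X : ℝ[X]) ^ d l • (P l).map Polynomial.C) 1 0)).eval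 t) := by ring
    have hapos := ha t ht
    nlinarith [hval, hid, sq_nonneg (2 * (((∑ l, (X : ℝ[X]) ^ d l • (Q l).map Polynomial.C) 0 0 * (∑ l, (X : ℝ[X]) ^ d l • (Q l).map Polynomial.C) 1 1 - (∑ l, (X : ℝ[X]) ^ d l • (Q l).map Polynomial.C) 0 1 * (∑ l, (X : ℝ[X]) ^ d l • (Q l).map Polynomial.C) 1 0)).eval t * ((∑ l, t ^ d l • P l) 0 0 / (∑ l, t ^ d l • Q l) 0 0) + ((-((∑ l, (X : ℝ[X]) ^ d l • (P l).map Polynomial.C) 0 0 * (∑ l, (X : ℝ[X]) ^ d l • (Q l).map Polynomial.C) 1 1 + (∑ l, (X : ℝ[X]) ^ d l • (P l).map Polynomial.C) 1 1 * (∑ l, (X : ℝ[X]) ^ d l • (Q l).map Polynomial.C) 0 0 - (∑ l, (X : ℝ[X]) ^ d l • (P l).map Polynomial.C) 0 1 * (∑ l, (X : ℝ[X]) ^ d l • (Q l).map Polynomial.C) 1 0 - (∑ l, (X : ℝ[X]) ^ d l • (P l).map Polynomial.C) 1 0 * (∑ l, (X : ℝ[X]) ^ d l • (Q l).map Polynomial.C)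 0 1))).eval t),
      sq_nonneg ((∑ l, t ^ d l • P l) 0 1 - ((∑ l, t ^ d l • P l) 0 0 / (∑ l, t ^ d l • Q l) 0 0) * (∑ l, t ^ d l • Q l) 0 1)]
  -- the fold curve count
  have hmain := FoldCurve.fold_curve_ncard_le _ _ _ _ (pairPoly_two_eq d P Q) ha hdisc hpos hfin
  refine hmain.trans (Nat.mul_le_mul_left 2 ?_)
  -- supports (forward style)
  have hEK : (Finset.univ.image d).card ≤ K := (Finset.card_image_le).trans (by simp)
  have hp00 := OsculationTwoK.support_pencil_apply d P 0 0
  have hp01 := OsculationTwoK.support_pencil_apply d P 0 1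
  have hp10 := OsculationTwoK.support_pencil_apply d P 1 0
  have hp11 := OsculationTwoK.support_pencil_apply d P 1 1
  have hq00 := OsculationTwoK.support_pencil_apply d Q 0 0
  have hq01 := OsculationTwoK.support_pencil_apply d Q 0 1
  have hq10 := OsculationTwoK.support_pencil_apply d Q 1 0
  have hq11 := OsculationTwoK.support_pencil_apply d Q 1 1
  have ha2 := OsculationCusp.supp_cast (n := 2)
    (OsculationCusp.supp_sub (OsculationCusp.supp_mul hq00 hq11) (OsculationCusp.supp_mul hq01 hq10)) rfl
  have hd2 := OsculationCusp.supp_cast (n := 2)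
    (OsculationCusp.supp_sub (OsculationCusp.supp_mul hp00 hp11) (OsculationCusp.supp_mul hp01 hp10)) rfl
  have hm2 := supp_neg' (OsculationCusp.supp_cast (n := 2)
    (OsculationCusp.supp_sub (OsculationCusp.supp_sub (OsculationCusp.supp_add
      (OsculationCusp.supp_mul hp00 hq11) (OsculationCusp.supp_mul hp11 hq00))
      (OsculationCusp.supp_mul hp01 hq10)) (OsculationCusp.supp_mul hp10 hq01)) rfl)
  have hN := (OsculationCusp.card_support_le_of_subset_nsmul (supp_N ha2 hm2 hd2)).trans
    (Nat.pow_le_pow_left hEK 8)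
  exact hN

/-- **`FoldLawAt 2 K (2 · K ^ 8)` in the line's v2 (`κ_min`) form**, VERBATIM unfolded: every symmetric
`(2, K)` pencil with an admissible split has an admissible split with at most `2K⁸` fold points — namely the
given one (`foldLawAt_two`). -/
theorem foldLawAt_two_kmin (K : ℕ) :
    ∀ (d : Fin K → ℕ) (S : Fin K → Matrix (Fin 2) (Fin 2) ℝ), (∀ l, (S l).IsSymm) →
      (∃ P Q : Fin K → Matrix (Fin 2) (Fin 2) ℝ,
        ((∀ l, (P l).PosSemidef) ∧ (∀ l, (Q l).PosSemidef) ∧ (∑ l, P l).PosDef ∧ (∑ l, Q l).PosDef) ∧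
        (∀ l, S l = P l - Q l) ∧
        (∀ p : Fin 2 → ℝ, 0 < p 0 → MvPolynomial.eval p (∑ l, (MvPolynomial.X (0 : Fin 2) : MvPolynomial (Fin 2) ℝ) ^ d l •
              ((P l).map (MvPolynomial.C : ℝ →+* MvPolynomial (Fin 2) ℝ)
                - (MvPolynomial.X (1 : Fin 2) : MvPolynomial (Fin 2) ℝ) • (Q l).map (MvPolynomial.C : ℝ →+* MvPolynomial (Fin 2) ℝ))).det = 0 →
          MvPolynomial.eval p (MvPolynomial.pderiv 1 (∑ l, (MvPolynomial.X (0 : Fin 2) : MvPolynomial (Fin 2) ℝ) ^ d l •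
              ((P l).map (MvPolynomial.C : ℝ →+* MvPolynomial (Fin 2) ℝ)
                - (MvPolynomial.X (1 : Fin 2) : MvPolynomial (Fin 2) ℝ) • (Q l).map (MvPolynomial.C : ℝ →+* MvPolynomial (Fin 2) ℝ))).det) ≠ 0) ∧
        {p : Fin 2 → ℝ | 0 < p 0 ∧ 0 < p 1 ∧ MvPolynomial.eval p (∑ l, (MvPolynomial.X (0 : Fin 2) : MvPolynomial (Fin 2) ℝ) ^ d l •
              ((P l).map (MvPolynomial.C : ℝ →+* MvPolynomial (Fin 2) ℝ)
                - (MvPolynomial.X (1 : Fin 2) : MvPolynomial (Fin 2) ℝ) • (Q l).map (MvPolynomial.C : ℝ →+* MvPolynomial (Fin 2) ℝ))).det = 0 ∧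
      MvPolynomial.eval p (MvPolynomial.X 0 * MvPolynomial.pderiv 0 (∑ l, (MvPolynomial.X (0 : Fin 2) : MvPolynomial (Fin 2) ℝ) ^ d l •
              ((P l).map (MvPolynomial.C : ℝ →+* MvPolynomial (Fin 2) ℝ)
                - (MvPolynomial.X (1 : Fin 2) : MvPolynomial (Fin 2) ℝ) • (Q l).map (MvPolynomial.C : ℝ →+* MvPolynomial (Fin 2) ℝ))).det) = 0}.Finite) →
      ∃ P Q : Fin K → Matrix (Fin 2) (Fin 2) ℝ,
        (((∀ l, (P l).PosSemidef) ∧ (∀ l, (Q l).PosSemidef) ∧ (∑ l, P l).PosDef ∧ (∑ l, Q l).PosDef) ∧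
          (∀ l, S l = P l - Q l) ∧
          (∀ p : Fin 2 → ℝ, 0 < p 0 → MvPolynomial.eval p (∑ l, (MvPolynomial.X (0 : Fin 2) : MvPolynomial (Fin 2) ℝ) ^ d l •
              ((P l).map (MvPolynomial.C : ℝ →+* MvPolynomial (Fin 2) ℝ)
                - (MvPolynomial.X (1 : Fin 2) : MvPolynomial (Fin 2) ℝ) • (Q l).map (MvPolynomial.C : ℝ →+* MvPolynomial (Fin 2) ℝ))).det = 0 →
            MvPolynomial.eval p (MvPolynomial.pderiv 1 (∑ l, (MvPolynomial.X (0 : Fin 2) : MvPolynomial (Fin 2) ℝ) ^ d l •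
              ((P l).map (MvPolynomial.C : ℝ →+* MvPolynomial (Fin 2) ℝ)
                - (MvPolynomial.X (1 : Fin 2) : MvPolynomial (Fin 2) ℝ) • (Q l).map (MvPolynomial.C : ℝ →+* MvPolynomial (Fin 2) ℝ))).det) ≠ 0) ∧
          {p : Fin 2 → ℝ | 0 < p 0 ∧ 0 < p 1 ∧ MvPolynomial.eval p (∑ l, (MvPolynomial.X (0 : Fin 2) : MvPolynomial (Fin 2) ℝ) ^ d l •
              ((P l).map (MvPolynomial.C : ℝ →+* MvPolynomial (Fin 2) ℝ)
                - (MvPolynomial.X (1 : Fin 2) : MvPolynomial (Fin 2) ℝ) • (Q l).map (MvPolynomial.C : ℝ →+* MvPolynomial (Fin 2) ℝ))).det = 0 ∧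
      MvPolynomial.eval p (MvPolynomial.X 0 * MvPolynomial.pderiv 0 (∑ l, (MvPolynomial.X (0 : Fin 2) : MvPolynomial (Fin 2) ℝ) ^ d l •
              ((P l).map (MvPolynomial.C : ℝ →+* MvPolynomial (Fin 2) ℝ)
                - (MvPolynomial.X (1 : Fin 2) : MvPolynomial (Fin 2) ℝ) • (Q l).map (MvPolynomial.C : ℝ →+* MvPolynomial (Fin 2) ℝ))).det) = 0}.Finite) ∧
        {p : Fin 2 → ℝ | 0 < p 0 ∧ 0 < p 1 ∧ MvPolynomial.eval p (∑ l, (MvPolynomial.X (0 : Fin 2) : MvPolynomial (Fin 2) ℝ) ^ d l •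
              ((P l).map (MvPolynomial.C : ℝ →+* MvPolynomial (Fin 2) ℝ)
                - (MvPolynomial.X (1 : Fin 2) : MvPolynomial (Fin 2) ℝ) • (Q l).map (MvPolynomial.C : ℝ →+* MvPolynomial (Fin 2) ℝ))).det = 0 ∧
      MvPolynomial.eval p (MvPolynomial.X 0 * MvPolynomial.pderiv 0 (∑ l, (MvPolynomial.X (0 : Fin 2) : MvPolynomial (Fin 2) ℝ) ^ d l •
              ((P l).map (MvPolynomial.C : ℝ →+* MvPolynomial (Fin 2) ℝ)
                - (MvPolynomial.X (1 : Fin 2) : MvPolynomial (Fin 2) ℝ) • (Q l).map (MvPolynomial.C : ℝ →+* MvPolynomial (Fin 2) ℝ))).det) = 0}.ncard ≤ 2 * K ^ 8 := by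
  intro d S _hS hex
  obtain ⟨P, Q, hA⟩ := hex
  exact ⟨P, Q, hA, foldLawAt_two K d P Q hA.1 hA.2.2.1 hA.2.2.2⟩


end FoldTwoK

end Summit.ValiantsHypothesis.ValiantsHypothesis.Theorems.LacunarySymmetroidMatrixDescartes
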